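import Mathlib
import Summits.NavierStokesRegularity.NavierStokesRegularity.Theorems.ScenarioCensusPeriodicSlabBounds
import HarnessLib

/-!
# Census row S7 (bounded steady flows in the periodic slab, case (d)): the weighted dyadic
# energy inequality

Support file for the scenario census of `NavierStokesRegularity` (cell `pub/ns-census`, row S7 =
Bang–Gui–Wang–Xie 2025, Thm 1.4 (d); tree FACT
`Literature.Analysis.FluidPDE.BangGuiWangXie2025_periodicSlab_liouville`, second conjunct).
Printed proof, arXiv:2205.13259 §5 Step 4: in the energy identity for `w = ∂₃u` tested with the
horizontal cut-off `φ_R`, the convection term `∫ φ ⟪u, (w·∇)w⟫` is absorbed by the Wirtinger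
inequality when `‖u‖_∞ < 2π`, and the cut-off terms live on the annulus where `∇φ_R ≠ 0`. Here:
`dyadic_weighted_estimate`, that inequality on the dyadic annulus `{r ≤ ρ < 2r}` with
`φ = cylCutoff r (2r)`, for every `r ≥ 1` and every splitting parameter `λ > 0` of the pressure
term. Inputs by name: `window_identity` (`…PeriodicSlabWindow`), `slab_wirtinger`
(`…PeriodicSlabTools`), `volume_zSlab_inter_cyl_le`, `partial_bounds` (`…PeriodicSlabBounds`).
Sequel: `…PeriodicSlabEstimate`. No summit statement and no census row is proved in this file.

## References

* J. Bang, C. Gui, Y. Wang, C. Xie, J. Fluid Mech. 1005 (2025) A6 = arXiv:2205.13259, §5 Step 4.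
  [BangGuiWangXie2025]
-/

-- the summit and its single problem share the name (D-0017 nested layout)
set_option linter.dupNamespace false

noncomputable section

open MeasureTheory Set Function Filter InnerProductSpace
open scoped Topology ENNReal NNReal RealInnerProductSpace Laplacian ContDiff

namespace Summit.NavierStokesRegularity.NavierStokesRegularity.Theorems.ScenarioCensus.PeriodicSlab

open Literature.Analysis Literature.Analysis.FluidPDE

/-- **The weighted dyadic energy inequality** (Bang–Gui–Wang–Xie, §5 Step 4, on the dyadic
annulus `{r ≤ ρ < 2r}`). Let `U` be smooth, axially `L`-periodic, divergence free, `‖U‖ ≤ M`,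
`‖DU‖ ≤ K₁`, `‖D²U‖ ≤ K₂`; let `w = DU(·)e₃` be divergence free and solve
`ν Δw = (w·∇)U + (U·∇)w + ∇q` with an axially periodic `q ∈ C¹`, `|q| ≤ K₃`; assume
`M L/(2π) ≤ ν`; let `C₀` be the gradient constant of the tree's cylindrical cut-offs. Then for
`r ≥ 1`, `λ > 0`, with `φ = cylCutoff r (2r)`, `χ = 𝟙{r ≤ ρ < 2r}` and `S = zSlab L 0`:
`(ν − M L/(2π)) ∫_S φ|Dw|² ≤ γ (∫_S χ|Dw|²)/r + a λ r + c (∫_S χ|Dw|²)/(λ r)` with the explicit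
constants displayed in the statement (`κ = (L/(2π))²`). -/
theorem dyadic_weighted_estimate {ν L M K₁ K₂ K₃ C₀ : ℝ} (hν : 0 < ν) (hL : 0 < L)
    (hML : M * L / (2 * Real.pi) ≤ ν)
    {U : EuclideanSpace ℝ (Fin 3) → EuclideanSpace ℝ (Fin 3)} {q : EuclideanSpace ℝ (Fin 3) → ℝ}
    (hU : ContDiff ℝ (⊤ : ℕ∞) U) (hq : ContDiff ℝ 1 q) (hdivU : VectorCalculus.IsDivFree U)
    (hdivw : VectorCalculus.IsDivFree (fun y => fderiv ℝ U y eZ))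
    (hpde : ∀ x, ν • (Δ (fun y => fderiv ℝ U y eZ)) x =
      convect (fun y => fderiv ℝ U y eZ) U x + convect U (fun y => fderiv ℝ U y eZ) x +
        gradient q x)
    (hUper : IsAxiallyPeriodic L U) (hqper : IsAxiallyPeriodic L q)
    (hM : ∀ x, ‖U x‖ ≤ M) (hK₁ : ∀ x, ‖fderiv ℝ U x‖ ≤ K₁)
    (hK₂ : ∀ x, ‖iteratedFDeriv ℝ 2 U x‖ ≤ K₂) (hK₃ : ∀ x, |q x| ≤ K₃)
    (hC₀0 : 0 ≤ C₀) (hC₀ : ∀ (ρ₂ ρ₁ : ℝ), 0 ≤ ρ₂ → ρ₂ < ρ₁ → ∀ x : EuclideanSpace ℝ (Fin 3),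
      ‖fderiv ℝ (cylCutoff ρ₂ ρ₁) x‖ ≤ C₀ / (ρ₁ - ρ₂))
    {r : ℝ} (hr : 1 ≤ r) {lam : ℝ} (hlam : 0 < lam) :
    (ν - M * L / (2 * Real.pi)) *
        ∫ x in zSlab L 0, cylCutoff r (2 * r) x *
          frobeniusNormSq (fderiv ℝ (fun y => fderiv ℝ U y eZ) x) ≤
      C₀ * (3 * ν * (1 + (L / (2 * Real.pi)) ^ 2) / 2 + 3 * M * (L / (2 * Real.pi)) ^ 2 / 2) *
          (∫ x in zSlab L 0,
            {x | r ≤ cylRadius x ∧ cylRadius x < 2 * r}.indicator (fun _ => (1 : ℝ)) x *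
              frobeniusNormSq (fderiv ℝ (fun y => fderiv ℝ U y eZ) x)) / r +
        16 * C₀ * K₃ ^ 2 * L * lam * r +
        C₀ * (L / (2 * Real.pi)) ^ 2 / 2 *
          (∫ x in zSlab L 0,
            {x | r ≤ cylRadius x ∧ cylRadius x < 2 * r}.indicator (fun _ => (1 : ℝ)) x *
              frobeniusNormSq (fderiv ℝ (fun y => fderiv ℝ U y eZ) x)) / (lam * r) := by
  set w : EuclideanSpace ℝ (Fin 3) → EuclideanSpace ℝ (Fin 3) := fun y => fderiv ℝ U y eZ with hw
  set b := EuclideanSpace.basisFun (Fin 3) ℝ with hb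
  have hU1 : ContDiff ℝ 1 U := contDiff_infty.1 hU 1
  have hU2 : ContDiff ℝ 2 U := contDiff_infty.1 hU 2
  have hwS : ContDiff ℝ ∞ w := (hU.fderiv_right (m := ∞) le_rfl).clm_apply contDiff_const
  have hw2 : ContDiff ℝ 2 w := contDiff_infty.1 hwS 2
  have hw1 : ContDiff ℝ 1 w := contDiff_infty.1 hwS 1
  have hUc : Continuous U := hU1.continuous
  have hwc : Continuous w := hw1.continuous
  have hqc : Continuous q := hq.continuous
  have hDwc : Continuous (fderiv ℝ w) := hw1.continuous_fderiv one_ne_zero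
  have hFc : Continuous fun x => frobeniusNormSq (fderiv ℝ w x) :=
    continuous_frobeniusNormSq_fderiv hw1 one_ne_zero
  have hwper : IsAxiallyPeriodic L w := fun y => by
    show fderiv ℝ U (y + L • EuclideanSpace.single 2 1) eZ = fderiv ℝ U y eZ
    rw [isAxiallyPeriodic_fderiv hUper y]
  have hDwper : IsAxiallyPeriodic L (fderiv ℝ w) := isAxiallyPeriodic_fderiv hwper
  have hM0 : 0 ≤ M := (norm_nonneg _).trans (hM 0)
  have hK₁0 : 0 ≤ K₁ := (norm_nonneg _).trans (hK₁ 0)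
  have hK₃0 : 0 ≤ K₃ := (abs_nonneg _).trans (hK₃ 0)
  have heZ : ‖(eZ : EuclideanSpace ℝ (Fin 3))‖ = 1 := by simp [eZ]
  have hb2 : b 2 = eZ := by simp [hb, eZ]
  have hw_bd : ∀ x, ‖w x‖ ≤ K₁ := fun x => ((partial_bounds hU2 hK₂ x).2.2).trans (hK₁ x)
  have hDw_op : ∀ x, ‖fderiv ℝ w x‖ ≤ K₂ := fun x => (partial_bounds hU2 hK₂ x).1
  have hF_bd : ∀ x, frobeniusNormSq (fderiv ℝ w x) ≤ 3 * K₂ ^ 2 := fun x => (partial_bounds hU2 hK₂ x).2.1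
  have hF0 : ∀ x, 0 ≤ frobeniusNormSq (fderiv ℝ w x) := fun x => frobeniusNormSq_nonneg _
  have hd3 : ∀ x, ‖fderiv ℝ w x eZ‖ ^ 2 ≤ frobeniusNormSq (fderiv ℝ w x) := fun x => by
    rw [← hb2]; exact norm_apply_sq_le_frobeniusNormSq b _ 2
  have hdi : ∀ x i, ‖fderiv ℝ w x (b i)‖ ^ 2 ≤ frobeniusNormSq (fderiv ℝ w x) := fun x i =>
    norm_apply_sq_le_frobeniusNormSq b _ i
  have hop : ∀ x, ‖fderiv ℝ w x‖ ^ 2 ≤ frobeniusNormSq (fderiv ℝ w x) := fun x =>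
    sq_opNorm_le_frobeniusNormSq _
  set κ : ℝ := (L / (2 * Real.pi)) ^ 2 with hκ
  have hκ0 : 0 ≤ κ := sq_nonneg _
  have hπL : 0 < 2 * Real.pi / L := by positivity
  have hκinv : κ * (2 * Real.pi / L) ^ 2 = 1 := by rw [hκ]; field_simp
  have hr0 : 0 < r := by linarith
  have hr2 : r < 2 * r := by linarith
  -- the cut-off and the annulus
  set φ : EuclideanSpace ℝ (Fin 3) → ℝ := cylCutoff r (2 * r) with hφ
  have hφ1 : ContDiff ℝ 1 φ := contDiff_cylCutoff r (2 * r)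
  have hφc : Continuous φ := hφ1.continuous
  have hφm : Measurable φ := hφc.measurable
  have hφnn : ∀ x, 0 ≤ φ x := cylCutoff_nonneg r (2 * r)
  have hφle : ∀ x, φ x ≤ 1 := cylCutoff_le_one r (2 * r)
  have hφone : ∀ x, cylRadius x ≤ r → φ x = 1 := fun x hx => cylCutoff_eq_one hr0.le hr2 hx
  have hφzero : ∀ x, 2 * r ≤ cylRadius x → φ x = 0 := fun x hx => cylCutoff_eq_zero hr0.le hr2 hx
  have hφz : ∀ (x : EuclideanSpace ℝ (Fin 3)) (s : ℝ), φ (x + s • eZ) = φ x :=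
    fun x s => cylCutoff_add_smul_eZ r (2 * r) x s
  have hφper : IsAxiallyPeriodic L φ := isAxiallyPeriodic_cylCutoff L r (2 * r)
  have hDφn : ∀ x, ‖fderiv ℝ φ x‖ ≤ C₀ / r := fun x => by
    have := hC₀ r (2 * r) hr0.le hr2 x; rwa [show 2 * r - r = r by ring] at this
  set A : Set (EuclideanSpace ℝ (Fin 3)) := {x | r ≤ cylRadius x ∧ cylRadius x < 2 * r} with hA
  have hAm : MeasurableSet A :=
    (isClosed_le continuous_const continuous_cylRadius).measurableSet.inter
      (isOpen_lt continuous_cylRadius continuous_const).measurableSet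
  set χ : EuclideanSpace ℝ (Fin 3) → ℝ := A.indicator fun _ => (1 : ℝ) with hχ
  have hχm : Measurable χ := measurable_const.indicator hAm
  have hχnn : ∀ x, 0 ≤ χ x := fun x => Set.indicator_nonneg (fun _ _ => zero_le_one) x
  have hχle : ∀ x, χ x ≤ 1 := fun x => Set.indicator_le_self' (fun _ _ => zero_le_one) x
  have hcyl : ∀ (x : EuclideanSpace ℝ (Fin 3)) (s : ℝ), cylRadius (x + s • eZ) = cylRadius x :=
    fun x s => by simp [cylRadius, eZ]
  have hχz : ∀ (x : EuclideanSpace ℝ (Fin 3)) (s : ℝ), χ (x + s • eZ) = χ x := fun x s => by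
    simp only [hχ, Set.indicator_apply, hA, mem_setOf_eq, hcyl]
  have hχzero : ∀ x, 2 * r ≤ cylRadius x → χ x = 0 := fun x hx => by
    simp only [hχ, Set.indicator_apply, hA, mem_setOf_eq]
    rw [if_neg]; exact fun h => absurd h.2 (not_lt.2 hx)
  -- `|Dφ(x) v| ≤ (C₀/r) χ(x) ‖v‖`
  have hDφ : ∀ (x v : EuclideanSpace ℝ (Fin 3)), |fderiv ℝ φ x v| ≤ C₀ / r * χ x * ‖v‖ := by
    intro x v
    by_cases hx : x ∈ A
    · have hχ1 : χ x = 1 := by simp [hχ, hx]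
      rw [hχ1, mul_one, ← Real.norm_eq_abs]
      exact (ContinuousLinearMap.le_opNorm _ _).trans
        (mul_le_mul_of_nonneg_right (hDφn x) (norm_nonneg _))
    · have hD0 : fderiv ℝ φ x = 0 := by
        simp only [hA, mem_setOf_eq, not_and_or, not_le, not_lt] at hx
        rcases hx with hx | hx
        · have hmax : IsLocalMax φ x :=
            Eventually.of_forall fun y => by rw [hφone x hx.le]; exact hφle y
          exact hmax.fderiv_eq_zero
        · have hmin : IsLocalMin φ x :=
            Eventually.of_forall fun y => by rw [hφzero x hx]; exact hφnn y
          exact hmin.fderiv_eq_zero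
      rw [hD0]; simp only [zero_apply, abs_zero]
      exact mul_nonneg (mul_nonneg (div_nonneg hC₀0 hr0.le) (hχnn x)) (norm_nonneg _)
  have wi := window_identity hL hU1 hw2 hq hdivU hdivw hpde hUper hwper hqper hφ1 hφper hφnn hφzero
  set S : Set (EuclideanSpace ℝ (Fin 3)) := zSlab L 0 with hS
  set F : EuclideanSpace ℝ (Fin 3) → ℝ := fun x => frobeniusNormSq (fderiv ℝ w x) with hF
  set Iφ : ℝ := ∫ x in S, φ x * F x with hIφ
  set D : ℝ := ∫ x in S, χ x * F x with hD
  set Jφ : ℝ := ∫ x in S, φ x * ‖w x‖ ^ 2 with hJφ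
  set JA : ℝ := ∫ x in S, χ x * ‖w x‖ ^ 2 with hJA
  -- integrability on the slab: continuous × cut-off, and indicator × bounded
  have hint_c : ∀ {G : EuclideanSpace ℝ (Fin 3) → ℝ}, Continuous G →
      (∀ x, 2 * r ≤ cylRadius x → G x = 0) → IntegrableOn G S volume := fun hG hG0 =>
    integrableOn_zSlab_of_eq_zero_of_le_cylRadius hG hG0 L 0
  have hint_χ : ∀ {G : EuclideanSpace ℝ (Fin 3) → ℝ}, Continuous G → ∀ {B : ℝ}, (∀ x, |G x| ≤ B) →
      IntegrableOn (fun x => χ x * G x) S volume := by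
    intro G hG B hB
    refine integrableOn_zSlab_of_bound hL ((hχm.mul hG.measurable).aestronglyMeasurable)
      (ρ := 2 * r) (fun x hx => by rw [hχzero x hx, zero_mul]) (B := B) fun x _ => ?_
    rw [Real.norm_eq_abs, abs_mul, abs_of_nonneg (hχnn x)]
    exact (mul_le_mul_of_nonneg_right (hχle x) (abs_nonneg _)).trans (by rw [one_mul]; exact hB x)
  have hIφ_int : IntegrableOn (fun x => φ x * F x) S volume :=
    hint_c (hφc.mul hFc) fun x hx => by rw [hφzero x hx, zero_mul]
  have hJφ_int : IntegrableOn (fun x => φ x * ‖w x‖ ^ 2) S volume :=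
    hint_c (hφc.mul (hwc.norm.pow 2)) fun x hx => by rw [hφzero x hx, zero_mul]
  have hD_int : IntegrableOn (fun x => χ x * F x) S volume :=
    hint_χ hFc (B := 3 * K₂ ^ 2) fun x => by rw [abs_of_nonneg (hF0 x)]; exact hF_bd x
  have hJA_int : IntegrableOn (fun x => χ x * ‖w x‖ ^ 2) S volume :=
    hint_χ (hwc.norm.pow 2) (B := K₁ ^ 2) fun x => by
      rw [abs_of_nonneg (sq_nonneg _)]; exact pow_le_pow_left₀ (norm_nonneg _) (hw_bd x) 2
  have hIφ0 : 0 ≤ Iφ := setIntegral_nonneg (measurableSet_zSlab L 0) fun x _ =>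
    mul_nonneg (hφnn x) (hF0 x)
  have hD0' : 0 ≤ D := setIntegral_nonneg (measurableSet_zSlab L 0) fun x _ =>
    mul_nonneg (hχnn x) (hF0 x)
  have hJA0 : 0 ≤ JA := setIntegral_nonneg (measurableSet_zSlab L 0) fun x _ =>
    mul_nonneg (hχnn x) (sq_nonneg _)
  -- Wirtinger: `Jφ ≤ κ Iφ`, `JA ≤ κ D`
  have hWφ : Jφ ≤ κ * Iφ := by
    have h1 := slab_wirtinger hL hU2 hUper hφm hφnn hφz hφle (ρ := 2 * r) hφzero
    have h2 : ∫ x in S, φ x * ‖fderiv ℝ (fun y => fderiv ℝ U y eZ) x eZ‖ ^ 2 ≤ Iφ := by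
      refine setIntegral_mono_on ?_ hIφ_int (measurableSet_zSlab L 0) fun x _ =>
        mul_le_mul_of_nonneg_left (hd3 x) (hφnn x)
      exact hint_c (hφc.mul ((hDwc.clm_apply continuous_const).norm.pow 2))
        fun x hx => by rw [hφzero x hx, zero_mul]
    have h3 : (2 * Real.pi / L) ^ 2 * Jφ ≤ Iφ := h1.trans h2
    calc Jφ = κ * ((2 * Real.pi / L) ^ 2 * Jφ) := by rw [← mul_assoc, hκinv, one_mul]
      _ ≤ κ * Iφ := mul_le_mul_of_nonneg_left h3 hκ0
  have hWA : JA ≤ κ * D := by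
    have h1 := slab_wirtinger hL hU2 hUper hχm hχnn hχz hχle (ρ := 2 * r) hχzero
    have h2 : ∫ x in S, χ x * ‖fderiv ℝ (fun y => fderiv ℝ U y eZ) x eZ‖ ^ 2 ≤ D := by
      refine setIntegral_mono_on ?_ hD_int (measurableSet_zSlab L 0) fun x _ =>
        mul_le_mul_of_nonneg_left (hd3 x) (hχnn x)
      exact hint_χ ((hDwc.clm_apply continuous_const).norm.pow 2) (B := K₂ ^ 2) fun x => by
        rw [abs_of_nonneg (sq_nonneg _)]
        refine pow_le_pow_left₀ (norm_nonneg _) ?_ 2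
        calc ‖fderiv ℝ w x eZ‖ ≤ ‖fderiv ℝ w x‖ * ‖(eZ : EuclideanSpace ℝ (Fin 3))‖ :=
              ContinuousLinearMap.le_opNorm _ _
          _ ≤ K₂ := by rw [heZ, mul_one]; exact hDw_op x
    have h3 : (2 * Real.pi / L) ^ 2 * JA ≤ D := h1.trans h2
    calc JA = κ * ((2 * Real.pi / L) ^ 2 * JA) := by rw [← mul_assoc, hκinv, one_mul]
      _ ≤ κ * D := mul_le_mul_of_nonneg_left h3 hκ0
  -- T1: the Green terms
  have hT1 : ∀ i, |∫ x in S, fderiv ℝ φ x (b i) * ⟪fderiv ℝ w x (b i), w x⟫| ≤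
      C₀ / (2 * r) * (D + JA) := by
    intro i
    have hbi : ‖b i‖ = 1 := b.orthonormal.1 i
    have hg_int : IntegrableOn (fun x => C₀ / (2 * r) * (χ x * F x + χ x * ‖w x‖ ^ 2)) S volume :=
      (hD_int.add hJA_int).const_mul _
    have h1 := norm_integral_le_of_norm_le (μ := volume.restrict S) hg_int
      (Eventually.of_forall fun x => (?_ :
        ‖fderiv ℝ φ x (b i) * ⟪fderiv ℝ w x (b i), w x⟫‖ ≤
          C₀ / (2 * r) * (χ x * F x + χ x * ‖w x‖ ^ 2)))
    · rw [Real.norm_eq_abs] at h1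
      refine h1.trans (le_of_eq ?_)
      rw [integral_const_mul, integral_add hD_int hJA_int]
    · rw [norm_mul, Real.norm_eq_abs]
      have h2 : |fderiv ℝ φ x (b i)| ≤ C₀ / r * χ x := by
        have := hDφ x (b i); rwa [hbi, mul_one] at this
      have h3 : ‖⟪fderiv ℝ w x (b i), w x⟫‖ ≤ ‖fderiv ℝ w x (b i)‖ * ‖w x‖ := norm_inner_le_norm _ _
      have h4 : ‖fderiv ℝ w x (b i)‖ * ‖w x‖ ≤ (F x + ‖w x‖ ^ 2) / 2 := by
        have h6 := two_mul_le_add_sq ‖fderiv ℝ w x (b i)‖ ‖w x‖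
        have h7 := hdi x i
        linarith only [h6, h7]
      have h5 : 0 ≤ C₀ / r * χ x := mul_nonneg (div_nonneg hC₀0 hr0.le) (hχnn x)
      calc |fderiv ℝ φ x (b i)| * ‖⟪fderiv ℝ w x (b i), w x⟫‖
          ≤ (C₀ / r * χ x) * ((F x + ‖w x‖ ^ 2) / 2) :=
            mul_le_mul h2 (h3.trans h4) (norm_nonneg _) h5
        _ = C₀ / (2 * r) * (χ x * F x + χ x * ‖w x‖ ^ 2) := by ring
  have hT1s : |∑ i, ∫ x in S, fderiv ℝ φ x (b i) * ⟪fderiv ℝ w x (b i), w x⟫| ≤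
      3 * (C₀ / (2 * r) * (D + JA)) := by
    refine (Finset.abs_sum_le_sum_abs _ _).trans ?_
    calc ∑ i, |∫ x in S, fderiv ℝ φ x (b i) * ⟪fderiv ℝ w x (b i), w x⟫|
        ≤ ∑ _i : Fin 3, C₀ / (2 * r) * (D + JA) := Finset.sum_le_sum fun i _ => hT1 i
      _ = 3 * (C₀ / (2 * r) * (D + JA)) := by simp
  have hT2 : |∫ x in S, fderiv ℝ φ x (U x) * ‖w x‖ ^ 2| ≤ C₀ * M / r * JA := by
    have hg_int : IntegrableOn (fun x => C₀ * M / r * (χ x * ‖w x‖ ^ 2)) S volume :=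
      hJA_int.const_mul _
    have h1 := norm_integral_le_of_norm_le (μ := volume.restrict S) hg_int
      (Eventually.of_forall fun x => (?_ :
        ‖fderiv ℝ φ x (U x) * ‖w x‖ ^ 2‖ ≤ C₀ * M / r * (χ x * ‖w x‖ ^ 2)))
    · rw [Real.norm_eq_abs] at h1
      refine h1.trans (le_of_eq ?_)
      rw [integral_const_mul]
    · rw [norm_mul, Real.norm_eq_abs, Real.norm_eq_abs, abs_of_nonneg (sq_nonneg ‖w x‖)]
      have h2 : |fderiv ℝ φ x (U x)| ≤ C₀ / r * χ x * M :=
        (hDφ x (U x)).trans (mul_le_mul_of_nonneg_left (hM x)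
          (mul_nonneg (div_nonneg hC₀0 hr0.le) (hχnn x)))
      calc |fderiv ℝ φ x (U x)| * ‖w x‖ ^ 2 ≤ (C₀ / r * χ x * M) * ‖w x‖ ^ 2 :=
            mul_le_mul_of_nonneg_right h2 (sq_nonneg _)
        _ = C₀ * M / r * (χ x * ‖w x‖ ^ 2) := by ring
  have hT3 : |∫ x in S, fderiv ℝ φ x (w x) * ⟪U x, w x⟫| ≤ C₀ * M / r * JA := by
    have hg_int : IntegrableOn (fun x => C₀ * M / r * (χ x * ‖w x‖ ^ 2)) S volume :=
      hJA_int.const_mul _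
    have h1 := norm_integral_le_of_norm_le (μ := volume.restrict S) hg_int
      (Eventually.of_forall fun x => (?_ :
        ‖fderiv ℝ φ x (w x) * ⟪U x, w x⟫‖ ≤ C₀ * M / r * (χ x * ‖w x‖ ^ 2)))
    · rw [Real.norm_eq_abs] at h1
      refine h1.trans (le_of_eq ?_)
      rw [integral_const_mul]
    · rw [norm_mul, Real.norm_eq_abs]
      have h2 : |fderiv ℝ φ x (w x)| ≤ C₀ / r * χ x * ‖w x‖ := hDφ x (w x)
      have h3 : ‖⟪U x, w x⟫‖ ≤ M * ‖w x‖ :=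
        (norm_inner_le_norm _ _).trans (mul_le_mul_of_nonneg_right (hM x) (norm_nonneg _))
      have h5 : 0 ≤ C₀ / r * χ x * ‖w x‖ :=
        mul_nonneg (mul_nonneg (div_nonneg hC₀0 hr0.le) (hχnn x)) (norm_nonneg _)
      calc |fderiv ℝ φ x (w x)| * ‖⟪U x, w x⟫‖ ≤ (C₀ / r * χ x * ‖w x‖) * (M * ‖w x‖) :=
            mul_le_mul h2 h3 (norm_nonneg _) h5
        _ = C₀ * M / r * (χ x * ‖w x‖ ^ 2) := by ring
  -- T4: absorption by the sharp Wirtinger inequality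
  set t : ℝ := 2 * Real.pi / L with ht
  have ht0 : 0 < t := hπL
  have hT4 : ∫ x in S, φ x * ⟪U x, fderiv ℝ w x (w x)⟫ ≤ M * L / (2 * Real.pi) * Iφ := by
    have hg_int : IntegrableOn (fun x => M * t / 2 * (φ x * ‖w x‖ ^ 2) + M / (2 * t) * (φ x * F x))
        S volume := (hJφ_int.const_mul _).add (hIφ_int.const_mul _)
    have hf_int : IntegrableOn (fun x => φ x * ⟪U x, fderiv ℝ w x (w x)⟫) S volume :=
      hint_c (hφc.mul (hUc.inner (hDwc.clm_apply hwc))) fun x hx => by rw [hφzero x hx, zero_mul]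
    have h1 : ∫ x in S, φ x * ⟪U x, fderiv ℝ w x (w x)⟫ ≤
        ∫ x in S, (M * t / 2 * (φ x * ‖w x‖ ^ 2) + M / (2 * t) * (φ x * F x)) := by
      refine setIntegral_mono_on hf_int hg_int (measurableSet_zSlab L 0) fun x _ => ?_
      have h2 : ⟪U x, fderiv ℝ w x (w x)⟫ ≤ M * (‖fderiv ℝ w x‖ * ‖w x‖) :=
        (real_inner_le_norm _ _).trans (mul_le_mul (hM x) (ContinuousLinearMap.le_opNorm _ _)
          (norm_nonneg _) hM0)
      have h3 : ‖fderiv ℝ w x‖ * ‖w x‖ ≤ (t * ‖w x‖ ^ 2 + F x / t) / 2 := by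
        have h4 : ‖fderiv ℝ w x‖ * ‖w x‖ ≤ (t * ‖w x‖ ^ 2 + ‖fderiv ℝ w x‖ ^ 2 / t) / 2 := by
          have key : 0 ≤ (t * ‖w x‖ - ‖fderiv ℝ w x‖) ^ 2 / t := by positivity
          rw [alg_sq_div t ‖w x‖ ‖fderiv ℝ w x‖ ht0.ne'] at key
          linarith only [key]
        have h5 : ‖fderiv ℝ w x‖ ^ 2 / t ≤ F x / t := div_le_div_of_nonneg_right (hop x) ht0.le
        linarith only [h4, h5]
      calc φ x * ⟪U x, fderiv ℝ w x (w x)⟫ ≤ φ x * (M * ((t * ‖w x‖ ^ 2 + F x / t) / 2)) :=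
            mul_le_mul_of_nonneg_left (h2.trans (mul_le_mul_of_nonneg_left h3 hM0)) (hφnn x)
        _ = M * t / 2 * (φ x * ‖w x‖ ^ 2) + M / (2 * t) * (φ x * F x) := by ring
    have h6 : ∫ x in S, (M * t / 2 * (φ x * ‖w x‖ ^ 2) + M / (2 * t) * (φ x * F x)) =
        M * t / 2 * Jφ + M / (2 * t) * Iφ := by
      rw [integral_add (hJφ_int.const_mul _) (hIφ_int.const_mul _), integral_const_mul,
        integral_const_mul]
    rw [h6] at h1
    have h7 : M * t / 2 * Jφ ≤ M * t / 2 * (κ * Iφ) := mul_le_mul_of_nonneg_left hWφ (by positivity)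
    have h8 : M * t / 2 * (κ * Iφ) + M / (2 * t) * Iφ = M * L / (2 * Real.pi) * Iφ := by
      rw [ht, hκ]; exact alg_absorb M L Iφ hL.ne'
    linarith only [h1, h7, h8]
  -- T5: the pressure term
  set V : ℝ := ∫ x in S, χ x with hVdef
  have hV : V ≤ 32 * L * r ^ 2 := by
    have h1 : V = volume.real (S ∩ A) := by
      rw [hVdef, hχ, setIntegral_indicator hAm, setIntegral_const, smul_eq_mul, mul_one]
    rw [h1, measureReal_def]
    refine ENNReal.toReal_le_of_le_ofReal (by positivity) ?_
    calc volume (S ∩ A) ≤ volume (zSlab L 0 ∩ {x | cylRadius x < 2 * r}) :=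
          measure_mono fun x hx => ⟨hx.1, hx.2.2⟩
      _ ≤ ENNReal.ofReal (8 * L * (2 * r) ^ 2) := volume_zSlab_inter_cyl_le hL (by linarith)
      _ = ENNReal.ofReal (32 * L * r ^ 2) := by ring_nf
  have hχ_int : IntegrableOn χ S volume :=
    integrableOn_zSlab_of_bound hL hχm.aestronglyMeasurable (ρ := 2 * r) hχzero (B := 1)
      fun x _ => by rw [Real.norm_eq_abs, abs_of_nonneg (hχnn x)]; exact hχle x
  have hT5 : |∫ x in S, q x * fderiv ℝ φ x (w x)| ≤
      16 * C₀ * K₃ ^ 2 * L * lam * r + C₀ / (2 * lam * r) * JA := by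
    have hg_int : IntegrableOn
        (fun x => C₀ * K₃ ^ 2 * lam / (2 * r) * χ x + C₀ / (2 * lam * r) * (χ x * ‖w x‖ ^ 2))
        S volume := (hχ_int.const_mul _).add (hJA_int.const_mul _)
    have h1 := norm_integral_le_of_norm_le (μ := volume.restrict S) hg_int
      (Eventually.of_forall fun x => (?_ :
        ‖q x * fderiv ℝ φ x (w x)‖ ≤
          C₀ * K₃ ^ 2 * lam / (2 * r) * χ x + C₀ / (2 * lam * r) * (χ x * ‖w x‖ ^ 2)))
    · rw [Real.norm_eq_abs] at h1
      have h2 : ∫ x in S, (C₀ * K₃ ^ 2 * lam / (2 * r) * χ x + C₀ / (2 * lam * r) * (χ x * ‖w x‖ ^ 2)) =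
          C₀ * K₃ ^ 2 * lam / (2 * r) * V + C₀ / (2 * lam * r) * JA := by
        rw [integral_add (hχ_int.const_mul _) (hJA_int.const_mul _), integral_const_mul,
          integral_const_mul]
      rw [h2] at h1
      have hc0 : 0 ≤ C₀ * K₃ ^ 2 * lam / (2 * r) := by positivity
      have h3 : C₀ * K₃ ^ 2 * lam / (2 * r) * V ≤ C₀ * K₃ ^ 2 * lam / (2 * r) * (32 * L * r ^ 2) :=
        mul_le_mul_of_nonneg_left hV hc0
      have h4 : C₀ * K₃ ^ 2 * lam / (2 * r) * (32 * L * r ^ 2) = 16 * C₀ * K₃ ^ 2 * L * lam * r :=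
        alg_volume C₀ K₃ lam L r hr0.ne'
      linarith only [h1, h3, h4]
    · rw [norm_mul, Real.norm_eq_abs, Real.norm_eq_abs]
      have h2 : |fderiv ℝ φ x (w x)| ≤ C₀ / r * χ x * ‖w x‖ := hDφ x (w x)
      have h3 : |q x| * |fderiv ℝ φ x (w x)| ≤ K₃ * (C₀ / r * χ x * ‖w x‖) :=
        mul_le_mul (hK₃ x) h2 (abs_nonneg _) hK₃0
      have h4 : K₃ * ‖w x‖ ≤ (lam * K₃ ^ 2 + ‖w x‖ ^ 2 / lam) / 2 := by
        have key : 0 ≤ (lam * K₃ - ‖w x‖) ^ 2 / lam := by positivity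
        rw [alg_sq_div lam K₃ ‖w x‖ hlam.ne'] at key
        linarith only [key]
      have h5 : 0 ≤ C₀ / r * χ x := mul_nonneg (div_nonneg hC₀0 hr0.le) (hχnn x)
      calc |q x| * |fderiv ℝ φ x (w x)| ≤ K₃ * (C₀ / r * χ x * ‖w x‖) := h3
        _ = (C₀ / r * χ x) * (K₃ * ‖w x‖) := by ring
        _ ≤ (C₀ / r * χ x) * ((lam * K₃ ^ 2 + ‖w x‖ ^ 2 / lam) / 2) :=
            mul_le_mul_of_nonneg_left h4 h5
        _ = C₀ * K₃ ^ 2 * lam / (2 * r) * χ x + C₀ / (2 * lam * r) * (χ x * ‖w x‖ ^ 2) :=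
            alg_split C₀ r (χ x) lam K₃ ‖w x‖ hr0.ne' hlam.ne'
  have hν' : 0 ≤ ν - M * L / (2 * Real.pi) := sub_nonneg.2 hML
  have hmain : (ν - M * L / (2 * Real.pi)) * Iφ ≤
      C₀ * (3 * ν * (1 + κ) / 2 + 3 * M * κ / 2) * D / r + 16 * C₀ * K₃ ^ 2 * L * lam * r +
        C₀ * κ / 2 * D / (lam * r) := by
    have hwi : ν * Iφ = -(ν * ∑ i, ∫ x in S, fderiv ℝ φ x (b i) * ⟪fderiv ℝ w x (b i), w x⟫) +
        2⁻¹ * (∫ x in S, fderiv ℝ φ x (U x) * ‖w x‖ ^ 2) +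
        (∫ x in S, fderiv ℝ φ x (w x) * ⟪U x, w x⟫) +
        (∫ x in S, φ x * ⟪U x, fderiv ℝ w x (w x)⟫) +
        ∫ x in S, q x * fderiv ℝ φ x (w x) := wi
    have a1 := (abs_le.1 hT1s).1
    have a2 := (abs_le.1 hT2).2
    have a3 := (abs_le.1 hT3).2
    have a5 := (abs_le.1 hT5).2
    have hSum : -(∑ i, ∫ x in S, fderiv ℝ φ x (b i) * ⟪fderiv ℝ w x (b i), w x⟫) ≤
        3 * (C₀ / (2 * r) * (D + JA)) := by linarith only [a1]
    have b1 := mul_le_mul_of_nonneg_left hSum hν.le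
    have hDJ : D + JA ≤ D + κ * D := by linarith only [hWA]
    have b2 : ν * (3 * (C₀ / (2 * r) * (D + JA))) ≤ ν * (3 * (C₀ / (2 * r) * (D + κ * D))) :=
      mul_le_mul_of_nonneg_left (mul_le_mul_of_nonneg_left
        (mul_le_mul_of_nonneg_left hDJ (by positivity)) (by norm_num)) hν.le
    have b3 : C₀ * M / r * JA ≤ C₀ * M / r * (κ * D) := mul_le_mul_of_nonneg_left hWA (by positivity)
    have b4 : C₀ / (2 * lam * r) * JA ≤ C₀ / (2 * lam * r) * (κ * D) :=
      mul_le_mul_of_nonneg_left hWA (by positivity)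
    have e := alg_collect ν C₀ M κ D r lam hr0.ne' hlam.ne'
    linarith only [hwi, b1, b2, a2, a3, b3, hT4, a5, b4, e]
  exact hmain

end Summit.NavierStokesRegularity.NavierStokesRegularity.Theorems.ScenarioCensus.PeriodicSlab

end
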